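import Summits.Ventures.CertifiedManyBodySolver.Certificates.HubbardSquare_n1_obliqueStation_hf3_readers
import Summits.Ventures.CertifiedManyBodySolver.Certificates.HubbardSquare_U8_n1_tp3o10_lower_row821
import HarnessLib
import HarnessLib.Audit

/-!
# Ventures/CertifiedManyBodySolver — Certificates/HubbardSquare_n1_obliqueStation_hf3_discharge_r821.lean

HONEST FRAMING: BOOKKEEPING ONLY — the BY-VALUE hypothesis `h44v` of C-145 (hubbard-fast-reuse-2 g16, (N10) «n = 1 OBLIQUE STATION ON THE t′ = ±3/10
HALF-FILLING LOWERs -42, -44, -46», `Certificates/HubbardSquare_n1_stiffness_obliqueStation_hf3_*.lean`, readers `…_hf3_readers.lean`) IS, letter for letter,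
the landed claim node of CERTIFIED #821 (8, 1, +3/10) «M3 `GU8n1tp3o10`» (sr-mbsolver registry; lit-4 module `HubbardSquare_U8_n1_tp3o10_lower_row821.lean`, node `cert_r821_bs_GU8n1tp3o10_w3_b4_R2_ob5p2_kry1_kry2c3rel_hanK7B4D4_KN4_PR20d4_hanK8c2s_uprime : Prop :=
((-3364989166955548176494201/6044629098073145873530880 : ℚ) : ℝ) ≤ energyDensityTT' 1 (3/10) 8 1`) — so every word binding `h44v` (207 binders in 35 tree files at write, ONE shape: hf3_boxes 5 file(s) · hf3_points 10 file(s) · hf3_readers 1 file(s) · ms1_boxes 2 file(s) · ms1_points 1 file(s) · ms2_boxes 1 file(s) · ms2_points 2 file(s) · xl1_boxes 3 file(s) · xl1_points 10 file(s)) is BY NAME on #821 from this file on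
(the C-134 / #648 pattern; companions `…_hf3_discharge_r681.lean` (`h46v`, #681) and `…_hf3_discharge_r817.lean` (`h42v`, #817, C-203)).
The `t′ = −3/10` copy follows by evenness (`n1_hf3_floor_U8_tpm3o10_of_v`).
No word, no numeral, no new claim node, no definition, no `sorry`; not a registry row; no summit statement is proved by this seat.
-/

noncomputable section

namespace Summit.Ventures.CertifiedManyBodySolver.Certificates

open Literature.MathematicalPhysics.QuantumLattice
open Literature.MathematicalPhysics.QuantumLattice.ThermodynamicLimit

/-- `h44v` BY NAME: the claim node of CERTIFIED #821 is the inequality `-3364989166955548176494201/(5·2⁸⁰) ≤ e(1, 3/10, 8, 1)` itself. [cite: Griffiths1966, §II] -/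
theorem n1_hf3_h44v_of_node (h : cert_r821_bs_GU8n1tp3o10_w3_b4_R2_ob5p2_kry1_kry2c3rel_hanK7B4D4_KN4_PR20d4_hanK8c2s_uprime) :
    (((-3364989166955548176494201/6044629098073145873530880 : ℚ)) : ℝ) ≤ energyDensityTT' 1 (3/10) 8 1 := h

/-- The same row read at `t′ = −3/10` BY NAME (evenness at half filling, `n1_hf3_floor_U8_tpm3o10_of_v`). [cite: LiebWuPhysicaA2003, §1 eq. (3)] -/
theorem n1_hf3_floor_U8_tpm3o10_of_node (h : cert_r821_bs_GU8n1tp3o10_w3_b4_R2_ob5p2_kry1_kry2c3rel_hanK7B4D4_KN4_PR20d4_hanK8c2s_uprime) :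
    (((-3364989166955548176494201/6044629098073145873530880 : ℚ)) : ℝ) ≤ energyDensityTT' 1 (-3/10) 8 1 :=
  n1_hf3_floor_U8_tpm3o10_of_v (n1_hf3_h44v_of_node h)

end Summit.Ventures.CertifiedManyBodySolver.Certificates

end
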